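import Mathlib.MeasureTheory.VectorMeasure.Decomposition.RadonNikodym
import Mathlib.MeasureTheory.Function.SimpleFuncDenseLp
import Mathlib.Analysis.Normed.Module.HahnBanach
import Literature.Analysis.FunctionSpaces.LpDualityTestFunctions
import HarnessLib

/-!
# The Riesz representation theorem `(L^q)' = L^p` on a finite measure space, and for
# functionals on test functions supported in an open set of finite measure

Analysis/FunctionSpaces theorem file (everything proved, [folklore]; Brezis 2011, Thm. 4.11 and
Thm. 4.14: "let `1 < p < ∞` and `φ ∈ (L^p)'`; then there exists a unique `u ∈ L^{p'}` such that
`⟨φ, f⟩ = ∫ u f` for all `f ∈ L^p`, moreover `‖u‖_{p'} = ‖φ‖`"). It serves the duality step of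
the discharge of `Literature.Analysis.FluidPDE.HeatDivSourceGradientBound`
(`FluidPDE/SereginLocalStokesRegularity`), where a weak spatial gradient is *produced* from an
a priori bound `|∫ u ∂ₖφ| ≤ M ‖φ‖_{L³}` on test functions, so that the representing function
(in `L^{3/2}`) is not known to exist beforehand — the tree's "easy half"
`Literature.Analysis.FunctionSpaces.memLp_of_forall_test` (`LpDualityTestFunctions`) bounds a
function that is already given, and the Hilbert-space reductions of
`RieszRepresentationTestFields` (weights + Riesz–Fréchet) only reach representing exponents
`p ≥ 2`.

* `clmSignedMeasure` — the signed measure `A ↦ T(𝟙_A)` of a continuous linear functional `T`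
  on `L^q(μ)`, `μ` finite, `1 ≤ q < ∞` (σ-additivity: indicators of increasing unions converge in
  `L^q`, Mathlib's `tendsto_indicatorConstLp_set`);
* `exists_integrable_forall_indicatorConstLp_eq` — it is absolutely continuous, so by the
  Radon–Nikodym theorem for signed measures (Mathlib's
  `SignedMeasure.absolutelyContinuous_iff_withDensityᵥ_rnDeriv_eq`) `T(𝟙_A) = ∫_A g` for an
  integrable `g`;
* `clm_toLp_eq_integral_mul_of_bounded` — hence `T f = ∫ g f` for every bounded strongly
  measurable `f` (simple functions by linearity, bounded functions by bounded pointwise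
  approximation with simple functions, Mathlib's `StronglyMeasurable.approxBounded`, and
  dominated convergence on both sides);
* `exists_memLp_repr_of_forall_test_le` — **the theorem consumed downstream**: on a
  finite-dimensional real normed space with an additive Haar measure `μ`, if `Ω` is open with
  `μ Ω < ∞`, `1 < p, q < ∞` are conjugate, and `Λ` is a real functional on functions which is
  additive and homogeneous on the test functions supported in `Ω` with `|Λ φ| ≤ M ‖φ‖_{L^q(μ)}`
  there, then `Λ φ = ∫_Ω g φ dμ` for some `g ∈ L^p(Ω)` with `‖g‖_{L^p(Ω)} ≤ M` (Hahn–Banach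
  extension from the subspace of classes of test functions in `L^q(μ|_Ω)`, the three items above
  on the finite measure `μ|_Ω`, and the easy half `memLp_of_forall_test` for the norm bound).

## Mathlib

Used: `indicatorConstLp`, `tendsto_indicatorConstLp_set`, `indicatorConstLp_disjoint_union`,
`VectorMeasure`/`SignedMeasure`, `SignedMeasure.rnDeriv`, `SignedMeasure.integrable_rnDeriv`,
`SignedMeasure.absolutelyContinuous_iff_withDensityᵥ_rnDeriv_eq`, `withDensityᵥ_apply`,
`StronglyMeasurable.approxBounded`, `SimpleFunc.induction`, `exists_extension_norm_eq`
(Hahn–Banach). Mathlib (this pin) has the natural map `L^p → (L^q)'` (`MeasureTheory.Lp`,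
`Function/Holder`) but not its surjectivity (searched `dual`/`Riesz` in
`MeasureTheory/Function/LpSpace`, `Holder`).

## References

* H. Brezis, *Functional Analysis, Sobolev Spaces and Partial Differential Equations* (2011),
  Thm. 4.11, Thm. 4.14. [`Brezis2011`]
-/

noncomputable section

open MeasureTheory TopologicalSpace Set Function Filter Topology
open scoped ENNReal NNReal symmDiff

namespace Literature.Analysis.FunctionSpaces

/-! ### The signed measure of a functional on `L^q` of a finite measure space -/

section Abstract

variable {X : Type*} [MeasurableSpace X] {μ : Measure X} [IsFiniteMeasure μ]
variable {q : ℝ≥0∞} [Fact (1 ≤ q)]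

/-- The indicator `𝟙_A ∈ L^q(μ)` of a measurable set of a finite measure space. [folklore] -/
abbrev indLp (q : ℝ≥0∞) (μ : Measure X) [IsFiniteMeasure μ] {A : Set X} (hA : MeasurableSet A) :
    Lp ℝ q μ :=
  indicatorConstLp q hA (measure_ne_top μ A) (1 : ℝ)

omit [Fact (1 ≤ q)] in
/-- Indicators of finite disjoint unions are finite sums of indicators in `L^q`. [folklore] -/
theorem indLp_biUnion_finset {A : ℕ → Set X} (hA : ∀ i, MeasurableSet (A i))
    (hd : Pairwise (Disjoint on A)) (s : Finset ℕ) {B : Set X} (hB : B = ⋃ i ∈ s, A i)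
    (hBm : MeasurableSet B) :
    indLp q μ hBm = ∑ i ∈ s, indLp q μ (hA i) := by
  classical
  induction s using Finset.induction_on generalizing B with
  | empty =>
    subst hB
    simp only [Finset.notMem_empty, iUnion_of_empty, iUnion_empty, Finset.sum_empty]
    exact indicatorConstLp_empty
  | @insert a s has ih =>
    rw [Finset.set_biUnion_insert] at hB
    subst hB
    have hB'm : MeasurableSet (⋃ i ∈ s, A i) :=
      MeasurableSet.biUnion s.countable_toSet fun i _ => hA i
    have hdisj : Disjoint (A a) (⋃ i ∈ s, A i) := by
      rw [disjoint_iUnion₂_right]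
      intro i hi
      exact hd (fun h => has (h ▸ hi))
    rw [Finset.sum_insert has, ← ih rfl hB'm]
    exact indicatorConstLp_disjoint_union (hA a) hB'm (measure_ne_top μ _) (measure_ne_top μ _)
      hdisj (1 : ℝ)

/-- Indicators of the finite partial unions of a disjoint sequence of measurable sets converge in
`L^q(μ)`, `q < ∞`, `μ` finite, to the indicator of the union: `Σᵢ 𝟙_{Aᵢ} = 𝟙_{⋃ Aᵢ}`
unconditionally in `L^q`. [folklore] -/
theorem hasSum_indLp (hq : q ≠ ∞) {A : ℕ → Set X} (hA : ∀ i, MeasurableSet (A i))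
    (hd : Pairwise (Disjoint on A)) :
    HasSum (fun i => indLp q μ (hA i)) (indLp q μ (MeasurableSet.iUnion hA)) := by
  classical
  set U : Set X := ⋃ i, A i with hU
  have hBm : ∀ s : Finset ℕ, MeasurableSet (⋃ i ∈ s, A i) := fun s =>
    MeasurableSet.biUnion s.countable_toSet fun i _ => hA i
  have hsum : ∀ s : Finset ℕ, ∑ i ∈ s, indLp q μ (hA i) = indLp q μ (hBm s) := fun s =>
    (indLp_biUnion_finset hA hd s rfl (hBm s)).symm
  simp only [HasSum, SummationFilter.unconditional_filter, hsum]
  refine tendsto_indicatorConstLp_set hq ?_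
  -- `μ (B_s ∆ U) = μ U - μ B_s → 0`
  have hsub : ∀ s : Finset ℕ, (⋃ i ∈ s, A i) ⊆ U := fun s =>
    iUnion₂_subset fun i _ => subset_iUnion A i
  have hmeas : ∀ s : Finset ℕ, μ (⋃ i ∈ s, A i) = ∑ i ∈ s, μ (A i) := fun s =>
    measure_biUnion_finset (fun i _ j _ hij => hd hij) fun i _ => hA i
  have hUsum : HasSum (fun i => μ (A i)) (μ U) := by
    rw [hU, measure_iUnion hd hA]
    exact ENNReal.summable.hasSum
  have h1 : Tendsto (fun s : Finset ℕ => μ U - ∑ i ∈ s, μ (A i)) atTop (𝓝 (μ U - μ U)) :=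
    ENNReal.Tendsto.sub tendsto_const_nhds hUsum (Or.inl (measure_ne_top μ U))
  rw [tsub_self] at h1
  refine h1.congr fun s => ?_
  rw [symmDiff_of_le (hsub s), measure_sdiff (hsub s) (hBm s).nullMeasurableSet (measure_ne_top μ _),
    hmeas s]

/-- The set function `A ↦ T(𝟙_A)` of a continuous linear functional `T` on `L^q(μ)` (zero on
non-measurable sets). [folklore] -/
def clmSetFun (T : Lp ℝ q μ →L[ℝ] ℝ) (A : Set X) : ℝ :=
  open Classical in if hA : MeasurableSet A then T (indLp q μ hA) else 0

/-- Value of `clmSetFun` on a measurable set. [folklore] -/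
theorem clmSetFun_apply (T : Lp ℝ q μ →L[ℝ] ℝ) {A : Set X} (hA : MeasurableSet A) :
    clmSetFun T A = T (indLp q μ hA) := by
  unfold clmSetFun
  exact dif_pos hA

/-- Value of `clmSetFun` on a non-measurable set. [folklore] -/
theorem clmSetFun_of_not_measurableSet (T : Lp ℝ q μ →L[ℝ] ℝ) {A : Set X}
    (hA : ¬ MeasurableSet A) : clmSetFun T A = 0 := by
  unfold clmSetFun
  exact dif_neg hA

/-- **The signed measure of a functional on `L^q`**, `1 ≤ q < ∞`, `μ` finite: `A ↦ T(𝟙_A)` is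
σ-additive because `T` is continuous and linear and indicators of disjoint unions sum in `L^q`
(`hasSum_indLp`). [folklore] -/
def clmSignedMeasure (hq : q ≠ ∞) (T : Lp ℝ q μ →L[ℝ] ℝ) : SignedMeasure X where
  measureOf' := clmSetFun T
  empty' := by
    rw [clmSetFun_apply T MeasurableSet.empty]
    have h : indLp q μ (MeasurableSet.empty : MeasurableSet (∅ : Set X)) = 0 := indicatorConstLp_empty
    rw [h, map_zero]
  not_measurable' := fun A hA => clmSetFun_of_not_measurableSet T hA
  m_iUnion' := by
    intro A hA hd
    have h := T.hasSum (hasSum_indLp (μ := μ) hq hA hd)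
    convert h using 1
    · funext i
      exact clmSetFun_apply T (hA i)
    · exact clmSetFun_apply T (MeasurableSet.iUnion hA)

/-- Value of `clmSignedMeasure` on a measurable set. [folklore] -/
theorem clmSignedMeasure_apply (hq : q ≠ ∞) (T : Lp ℝ q μ →L[ℝ] ℝ) {A : Set X}
    (hA : MeasurableSet A) : clmSignedMeasure hq T A = T (indLp q μ hA) :=
  clmSetFun_apply T hA

/-- The signed measure of a functional on `L^q(μ)` is absolutely continuous with respect to `μ`
(a null set has indicator `0` in `L^q`). [folklore] -/
theorem clmSignedMeasure_absolutelyContinuous (hq : q ≠ ∞) (T : Lp ℝ q μ →L[ℝ] ℝ) :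
    clmSignedMeasure hq T ≪ᵥ μ.toENNRealVectorMeasure := by
  refine VectorMeasure.AbsolutelyContinuous.mk fun A hA hA0 => ?_
  rw [Measure.toENNRealVectorMeasure_apply_measurable hA] at hA0
  rw [clmSignedMeasure_apply hq T hA]
  have h0 : indLp q μ hA = 0 := by
    have hq0 : q ≠ 0 := (zero_lt_one.trans_le (Fact.out : 1 ≤ q)).ne'
    rw [← norm_eq_zero, norm_indicatorConstLp hq0 hq, measureReal_def, hA0, ENNReal.toReal_zero,
      Real.zero_rpow (one_div_ne_zero (ENNReal.toReal_ne_zero.2 ⟨hq0, hq⟩)), mul_zero]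
  rw [h0, map_zero]

/-- **Radon–Nikodym density of a functional on `L^q`**: for `T ∈ (L^q(μ))'`, `1 ≤ q < ∞`, `μ`
finite, there is an integrable `g` with `T(𝟙_A) = ∫_A g dμ` for every measurable `A`
(the Radon–Nikodym derivative of `clmSignedMeasure`). [folklore] -/
theorem exists_integrable_forall_indLp_eq (hq : q ≠ ∞) (T : Lp ℝ q μ →L[ℝ] ℝ) :
    ∃ g : X → ℝ, Integrable g μ ∧ ∀ (A : Set X) (hA : MeasurableSet A),
      T (indLp q μ hA) = ∫ x in A, g x ∂μ := by
  set ν := clmSignedMeasure hq T with hν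
  refine ⟨ν.rnDeriv μ, SignedMeasure.integrable_rnDeriv ν μ, fun A hA => ?_⟩
  have h := (SignedMeasure.absolutelyContinuous_iff_withDensityᵥ_rnDeriv_eq ν μ).1
    (clmSignedMeasure_absolutelyContinuous hq T)
  have h' : μ.withDensityᵥ (ν.rnDeriv μ) A = ν A := by rw [h]
  rw [withDensityᵥ_apply (SignedMeasure.integrable_rnDeriv ν μ) hA, hν,
    clmSignedMeasure_apply hq T hA] at h'
  exact h'.symm


/-! ### From indicators to simple and to bounded functions -/

omit [Fact (1 ≤ q)] in
/-- Indicators with a general constant are multiples of `𝟙_A`. [folklore] -/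
theorem indicatorConstLp_eq_smul_indLp {A : Set X} (hA : MeasurableSet A) (c : ℝ) :
    indicatorConstLp q hA (measure_ne_top μ A) c = c • indLp q μ hA := by
  ext1
  filter_upwards [indicatorConstLp_coeFn (p := q) (hs := hA) (hμs := measure_ne_top μ A) (c := c),
    Lp.coeFn_smul c (indLp q μ hA),
    indicatorConstLp_coeFn (p := q) (hs := hA) (hμs := measure_ne_top μ A) (c := (1 : ℝ))]
    with x hx hs h1
  rw [hx, hs, Pi.smul_apply, h1]
  by_cases hxA : x ∈ A
  · simp [hxA]
  · simp [hxA]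

omit [Fact (1 ≤ q)] in
/-- A simple function on a finite measure space is in every `L^q`. [folklore] -/
theorem memLp_simpleFunc (s : SimpleFunc X ℝ) : MemLp s q μ :=
  SimpleFunc.memLp_of_isFiniteMeasure s q μ

/-- **Simple functions**: if `T(𝟙_A) = ∫_A g` for every measurable `A`, then `T s = ∫ g s` for
every simple `s` (linearity; `SimpleFunc.induction`). [folklore] -/
theorem clm_toLp_simpleFunc_eq_integral_mul (T : Lp ℝ q μ →L[ℝ] ℝ) {g : X → ℝ}
    (hg : Integrable g μ)
    (hT : ∀ (A : Set X) (hA : MeasurableSet A), T (indLp q μ hA) = ∫ x in A, g x ∂μ)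
    (s : SimpleFunc X ℝ) :
    T ((memLp_simpleFunc s).toLp s) = ∫ x, g x * s x ∂μ := by
  induction s using SimpleFunc.induction with
  | @const c A hA =>
    have hfun : ⇑(SimpleFunc.piecewise A hA (SimpleFunc.const X c) (SimpleFunc.const X 0)) =
        A.indicator (fun _ => c) := by
      funext x
      by_cases hx : x ∈ A
      · simp [hx]
      · simp [hx]
    have h1 : (memLp_simpleFunc (μ := μ) (q := q)
          (SimpleFunc.piecewise A hA (SimpleFunc.const X c) (SimpleFunc.const X 0))).toLp _ =
        indicatorConstLp q hA (measure_ne_top μ A) c := by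
      rw [indicatorConstLp]
      exact MemLp.toLp_congr _ _ (Eventually.of_forall fun x => by rw [hfun])
    rw [h1, indicatorConstLp_eq_smul_indLp hA c, map_smul, hT A hA, smul_eq_mul, hfun]
    have h2 : (fun x => g x * A.indicator (fun _ => c) x) = A.indicator (fun x => g x * c) := by
      funext x
      by_cases hx : x ∈ A
      · simp [hx]
      · simp [hx]
    rw [h2, integral_indicator hA, integral_mul_const, mul_comm]
  | @add f f' hdisj hf hf' =>
    have h1 : (memLp_simpleFunc (μ := μ) (q := q) (f + f')).toLp _ =
        (memLp_simpleFunc (μ := μ) (q := q) f).toLp _ + (memLp_simpleFunc (μ := μ) (q := q) f').toLp _ := by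
      rw [← MemLp.toLp_add]
      exact MemLp.toLp_congr _ _ (Eventually.of_forall fun x => by simp)
    rw [h1, map_add, hf, hf']
    have hi : ∀ s : SimpleFunc X ℝ, Integrable (fun x => g x * s x) μ := fun s => by
      obtain ⟨C, hC⟩ := s.exists_forall_norm_le
      exact hg.mul_bdd s.aestronglyMeasurable (Eventually.of_forall hC)
    rw [← integral_add (hi f) (hi f')]
    refine integral_congr_ae (Eventually.of_forall fun x => ?_)
    simp only [SimpleFunc.coe_add, Pi.add_apply]
    ring

omit [IsFiniteMeasure μ] [Fact (1 ≤ q)] in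
/-- Bounded pointwise convergence is convergence in `L^q`, `q < ∞`, on a finite measure space
(dominated convergence). [folklore] -/
theorem tendsto_eLpNorm_sub_of_tendsto_of_bound [IsFiniteMeasure μ] (hq : q ≠ ∞) {s : ℕ → X → ℝ}
    {f : X → ℝ} (hsm : ∀ n, AEStronglyMeasurable (s n) μ) (hfm : AEStronglyMeasurable f μ) {C : ℝ}
    (hsC : ∀ n x, ‖s n x‖ ≤ C) (hfC : ∀ x, ‖f x‖ ≤ C)
    (hlim : ∀ x, Tendsto (fun n => s n x) atTop (𝓝 (f x))) :
    Tendsto (fun n => eLpNorm (s n - f) q μ) atTop (𝓝 0) := by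
  rcases eq_or_ne q 0 with rfl | hq0
  · simp
  have hr : 0 < q.toReal := ENNReal.toReal_pos hq0 hq
  -- the `q`-th powers converge by dominated convergence
  have hpow : Tendsto (fun n => ∫⁻ x, ‖(s n - f) x‖ₑ ^ q.toReal ∂μ) atTop (𝓝 0) := by
    have hb : ∀ n, ∀ᵐ x ∂μ, ‖(s n - f) x‖ₑ ^ q.toReal ≤ ENNReal.ofReal (C + C) ^ q.toReal := by
      intro n
      refine Eventually.of_forall fun x => ENNReal.rpow_le_rpow ?_ hr.le
      rw [← ofReal_norm]
      refine ENNReal.ofReal_le_ofReal ?_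
      exact (norm_sub_le _ _).trans (add_le_add (hsC n x) (hfC x))
    have hlim' : ∀ᵐ x ∂μ, Tendsto (fun n => ‖(s n - f) x‖ₑ ^ q.toReal) atTop (𝓝 0) := by
      refine Eventually.of_forall fun x => ?_
      have h1 : Tendsto (fun n => ‖(s n - f) x‖ₑ) atTop (𝓝 0) := by
        have h2 : Tendsto (fun n => s n x - f x) atTop (𝓝 0) := by
          simpa using (hlim x).sub_const (f x)
        have h3 := h2.enorm
        simpa using h3
      have h4 := ((ENNReal.continuous_rpow_const (y := q.toReal)).tendsto 0).comp h1
      rw [ENNReal.zero_rpow_of_pos hr] at h4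
      exact h4
    have hfin : ∫⁻ _ : X, ENNReal.ofReal (C + C) ^ q.toReal ∂μ ≠ ∞ := by
      rw [lintegral_const]
      exact ENNReal.mul_ne_top (ENNReal.rpow_ne_top_of_nonneg hr.le ENNReal.ofReal_ne_top)
        (measure_ne_top μ _)
    have h := tendsto_lintegral_of_dominated_convergence' (fun _ => ENNReal.ofReal (C + C) ^ q.toReal)
      (fun n => ((hsm n).sub hfm).enorm.pow_const _) hb hfin hlim'
    simpa [lintegral_zero] using h
  have h5 := ((ENNReal.continuous_rpow_const (y := 1 / q.toReal)).tendsto 0).comp hpow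
  simp only [Function.comp_def, ENNReal.zero_rpow_of_pos (one_div_pos.2 hr)] at h5
  refine h5.congr fun n => ?_
  rw [eLpNorm_eq_lintegral_rpow_enorm_toReal hq0 hq]

/-- **Bounded functions**: if `T(𝟙_A) = ∫_A g` for every measurable `A` (`g` integrable), then
`T f = ∫ g f` for every bounded strongly measurable `f` (approximate `f` boundedly and pointwise
by simple functions; `T` is continuous on `L^q`, `q < ∞`, and `∫ g ·` passes to the limit by
dominated convergence). [folklore] -/
theorem clm_toLp_eq_integral_mul_of_bounded (hq : q ≠ ∞) (T : Lp ℝ q μ →L[ℝ] ℝ) {g : X → ℝ}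
    (hg : Integrable g μ)
    (hT : ∀ (A : Set X) (hA : MeasurableSet A), T (indLp q μ hA) = ∫ x in A, g x ∂μ)
    {f : X → ℝ} (hfm : StronglyMeasurable f) {C : ℝ} (hfC : ∀ x, ‖f x‖ ≤ C) (hf : MemLp f q μ) :
    T (hf.toLp f) = ∫ x, g x * f x ∂μ := by
  have hC : 0 ≤ max C 0 := le_max_right _ _
  have hfC' : ∀ x, ‖f x‖ ≤ max C 0 := fun x => (hfC x).trans (le_max_left _ _)
  set s : ℕ → SimpleFunc X ℝ := hfm.approxBounded (max C 0) with hs_def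
  have hsC : ∀ n x, ‖s n x‖ ≤ max C 0 := fun n x => hfm.norm_approxBounded_le hC n x
  have hslim : ∀ x, Tendsto (fun n => s n x) atTop (𝓝 (f x)) := fun x =>
    hfm.tendsto_approxBounded_of_norm_le (hfC' x)
  -- `T` side
  have h1 : Tendsto (fun n => T ((memLp_simpleFunc (s n)).toLp (s n))) atTop (𝓝 (T (hf.toLp f))) := by
    refine (T.continuous.tendsto _).comp ?_
    rw [Lp.tendsto_Lp_iff_tendsto_eLpNorm'']
    exact tendsto_eLpNorm_sub_of_tendsto_of_bound hq (fun n => (s n).aestronglyMeasurable)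
      hfm.aestronglyMeasurable hsC hfC' hslim
  -- integral side
  have h2 : Tendsto (fun n => ∫ x, g x * s n x ∂μ) atTop (𝓝 (∫ x, g x * f x ∂μ)) := by
    refine tendsto_integral_of_dominated_convergence (fun x => max C 0 * ‖g x‖)
      (fun n => hg.1.mul (s n).aestronglyMeasurable) (hg.norm.const_mul (max C 0)) (fun n => ?_) ?_
    · refine Eventually.of_forall fun x => ?_
      rw [norm_mul, mul_comm]
      exact mul_le_mul_of_nonneg_right (hsC n x) (norm_nonneg _)
    · exact Eventually.of_forall fun x => (hslim x).const_mul (g x)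
  have h3 : (fun n => T ((memLp_simpleFunc (s n)).toLp (s n))) = fun n => ∫ x, g x * s n x ∂μ :=
    funext fun n => clm_toLp_simpleFunc_eq_integral_mul T hg hT (s n)
  rw [h3] at h1
  exact tendsto_nhds_unique h1 h2

/-- **Riesz representation on a finite measure space, bounded-function form**: for every
continuous linear functional `T` on `L^q(μ)`, `1 ≤ q < ∞`, `μ` finite, there is an integrable `g`
with `T f = ∫ g f dμ` for all bounded strongly measurable `f` (Brezis 2011, Thm. 4.11/4.14, the
representation; the integrability exponent of `g` is upgraded by the consumer). [folklore] -/
theorem exists_integrable_clm_eq_integral_mul (hq : q ≠ ∞) (T : Lp ℝ q μ →L[ℝ] ℝ) :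
    ∃ g : X → ℝ, Integrable g μ ∧ ∀ (f : X → ℝ), StronglyMeasurable f → (∃ C, ∀ x, ‖f x‖ ≤ C) →
      ∀ hf : MemLp f q μ, T (hf.toLp f) = ∫ x, g x * f x ∂μ := by
  obtain ⟨g, hg, hT⟩ := exists_integrable_forall_indLp_eq hq T
  exact ⟨g, hg, fun f hfm ⟨C, hC⟩ hf => clm_toLp_eq_integral_mul_of_bounded hq T hg hT hfm hC hf⟩

end Abstract

/-! ### Functionals on test functions supported in an open set of finite measure -/

section TestFunctions

variable {G : Type*} [NormedAddCommGroup G] [NormedSpace ℝ G] [FiniteDimensional ℝ G]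
  [MeasurableSpace G] [BorelSpace G] {μ : Measure G} [μ.IsAddHaarMeasure]

omit [FiniteDimensional ℝ G] [MeasurableSpace G] [BorelSpace G] in
/-- Test functions supported in `Ω` are stable under addition. [folklore] -/
private theorem testOn_add {Ω : Opens G} {φ ψ : G → ℝ} (hφ : IsTestFunctionOn Ω φ)
    (hψ : IsTestFunctionOn Ω ψ) : IsTestFunctionOn Ω (φ + ψ) := by
  refine ⟨hφ.contDiff.add hψ.contDiff, hφ.hasCompactSupport.add hψ.hasCompactSupport, ?_⟩
  refine (closure_mono (support_add φ ψ)).trans ?_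
  rw [closure_union]
  exact union_subset hφ.tsupport_subset hψ.tsupport_subset

omit [FiniteDimensional ℝ G] [MeasurableSpace G] [BorelSpace G] in
/-- Test functions supported in `Ω` are stable under scalar multiplication. [folklore] -/
private theorem testOn_smul {Ω : Opens G} {φ : G → ℝ} (hφ : IsTestFunctionOn Ω φ) (a : ℝ) :
    IsTestFunctionOn Ω (a • φ) :=
  ⟨hφ.contDiff.const_smul a, hφ.hasCompactSupport.smul_left,
    (tsupport_smul_subset_right (fun _ : G => a) φ).trans hφ.tsupport_subset⟩

omit [FiniteDimensional ℝ G] in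
/-- Two test functions supported in the open set `Ω` which agree a.e. on `Ω` (for an additive Haar
measure) are equal: their difference set is open, contained in `Ω`, and null. [folklore] -/
theorem IsTestFunctionOn.eq_of_ae_eq_restrict {Ω : Opens G} {ψ χ : G → ℝ}
    (hψ : IsTestFunctionOn Ω ψ) (hχ : IsTestFunctionOn Ω χ) (h : ψ =ᵐ[μ.restrict Ω] χ) :
    ψ = χ := by
  set D : Set G := {x | ψ x ≠ χ x} with hD
  have hDo : IsOpen D := isOpen_ne_fun hψ.contDiff.continuous hχ.contDiff.continuous
  have hDΩ : D ⊆ (Ω : Set G) := by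
    intro x hx
    by_cases hψx : ψ x = 0
    · have hχx : χ x ≠ 0 := fun h0 => hx (by rw [hψx, h0])
      exact hχ.tsupport_subset (subset_tsupport _ hχx)
    · exact hψ.tsupport_subset (subset_tsupport _ hψx)
  have hD0 : μ D = 0 := by
    have h' : ∀ᵐ x ∂μ, x ∈ (Ω : Set G) → ψ x = χ x := (ae_restrict_iff' Ω.isOpen.measurableSet).1 h
    have h'' : ∀ᵐ x ∂μ, x ∉ D := by
      filter_upwards [h'] with x hx hxD
      exact hxD (hx (hDΩ hxD))
    exact measure_eq_zero_iff_ae_notMem.2 h''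
  have hDe : D = ∅ := (hDo.measure_eq_zero_iff μ).1 hD0
  funext x
  by_contra hx
  have : x ∈ D := hx
  rw [hDe] at this
  exact this

/-- **Riesz representation for functionals on test functions supported in an open set of finite
measure** (Brezis 2011, Thm. 4.11 with the Hahn–Banach theorem). Let `μ` be an additive Haar
measure on a finite-dimensional real normed space, `Ω` open with `μ Ω < ∞`, `1 < p, q < ∞`
conjugate exponents, `0 ≤ M`, and `Λ` a real functional which is additive and homogeneous on the
test functions supported in `Ω` (`IsTestFunctionOn Ω`) and satisfies `|Λ φ| ≤ M ‖φ‖_{L^q(μ)}`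
there. Then there is `g ∈ L^p(Ω)` with `‖g‖_{L^p(Ω)} ≤ M` and `Λ φ = ∫_Ω g φ dμ` for every test
function `φ` supported in `Ω`. Proof: the classes of test functions form a subspace of
`L^q(μ|_Ω)` on which `Λ` is a well-defined (`IsTestFunctionOn.eq_of_ae_eq_restrict`) linear
functional of norm `≤ M`; extend by Hahn–Banach, represent the extension by an integrable `g`
(`exists_integrable_clm_eq_integral_mul`), and bound `‖g‖_{L^p(Ω)}` by the easy half of the
duality (`memLp_of_forall_test`). [folklore] -/
theorem exists_memLp_repr_of_forall_test_le {Ω : Opens G} (hΩ : μ (Ω : Set G) ≠ ∞)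
    {p q : ℝ} (hpq : p.HolderConjugate q) (Λ : (G → ℝ) → ℝ)
    (hadd : ∀ f g : G → ℝ, IsTestFunctionOn Ω f → IsTestFunctionOn Ω g → Λ (f + g) = Λ f + Λ g)
    (hsmul : ∀ (a : ℝ) (f : G → ℝ), IsTestFunctionOn Ω f → Λ (a • f) = a * Λ f)
    {M : ℝ} (hM : 0 ≤ M)
    (hbd : ∀ f : G → ℝ, IsTestFunctionOn Ω f → |Λ f| ≤ M * (eLpNorm f (ENNReal.ofReal q) μ).toReal) :
    ∃ g : G → ℝ, MemLp g (ENNReal.ofReal p) (μ.restrict Ω) ∧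
      eLpNorm g (ENNReal.ofReal p) (μ.restrict Ω) ≤ ENNReal.ofReal M ∧
      ∀ f : G → ℝ, IsTestFunctionOn Ω f → Λ f = ∫ x in (Ω : Set G), g x * f x ∂μ := by
  -- exponents and the finite measure `ν = μ|_Ω`
  have hq1 : 1 < q := hpq.symm.lt
  set Q : ℝ≥0∞ := ENNReal.ofReal q with hQ
  haveI hQ1 : Fact (1 ≤ Q) := ⟨by rw [hQ, ← ENNReal.ofReal_one]; exact ENNReal.ofReal_le_ofReal hq1.le⟩
  have hQtop : Q ≠ ∞ := ENNReal.ofReal_ne_top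
  set ν : Measure G := μ.restrict (Ω : Set G) with hν
  haveI : IsFiniteMeasure ν := ⟨by rw [hν, Measure.restrict_apply_univ]; exact hΩ.lt_top⟩
  -- test functions as elements of `L^Q(ν)`
  have hmem : ∀ {f : G → ℝ}, IsTestFunctionOn Ω f → MemLp f Q ν := fun hf =>
    (hf.contDiff.continuous.memLp_of_hasCompactSupport hf.hasCompactSupport).restrict _
  have hnorm : ∀ {f : G → ℝ}, IsTestFunctionOn Ω f → eLpNorm f Q ν = eLpNorm f Q μ :=
    fun {f} hf => by
    rw [hν, eLpNorm_restrict_eq_of_support_subset]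
    exact (subset_tsupport f).trans hf.tsupport_subset
  -- the subspace of classes of test functions
  let P : Submodule ℝ (Lp ℝ Q ν) :=
    { carrier := {F | ∃ ψ : G → ℝ, IsTestFunctionOn Ω ψ ∧ (F : G → ℝ) =ᵐ[ν] ψ}
      zero_mem' := ⟨0, isTestFunctionOn_zero _, Lp.coeFn_zero ℝ Q ν⟩
      add_mem' := by
        rintro F F' ⟨ψ, hψ, hF⟩ ⟨χ, hχ, hF'⟩
        exact ⟨ψ + χ, testOn_add hψ hχ, (Lp.coeFn_add F F').trans (hF.add hF')⟩
      smul_mem' := by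
        rintro a F ⟨ψ, hψ, hF⟩
        exact ⟨a • ψ, testOn_smul hψ a, (Lp.coeFn_smul a F).trans (hF.const_smul a)⟩ }
  have hmemP : ∀ {F : Lp ℝ Q ν}, F ∈ P ↔ ∃ ψ : G → ℝ, IsTestFunctionOn Ω ψ ∧ (F : G → ℝ) =ᵐ[ν] ψ :=
    Iff.rfl
  -- a representative and its value
  have hrep : ∀ F : P, ∃ ψ : G → ℝ, IsTestFunctionOn Ω ψ ∧ ((F : Lp ℝ Q ν) : G → ℝ) =ᵐ[ν] ψ :=
    fun F => hmemP.1 F.2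
  choose rep hrep_test hrep_ae using hrep
  -- uniqueness of representatives
  have huniq : ∀ (F : P) {ψ : G → ℝ}, IsTestFunctionOn Ω ψ → ((F : Lp ℝ Q ν) : G → ℝ) =ᵐ[ν] ψ →
      rep F = ψ := fun F ψ hψ hF =>
    (hrep_test F).eq_of_ae_eq_restrict hψ ((hrep_ae F).symm.trans hF)
  -- `Λ` descends to a linear functional on `P`
  let L0 : P →ₗ[ℝ] ℝ :=
    { toFun := fun F => Λ (rep F)
      map_add' := fun F F' => by
        have h1 : rep (F + F') = rep F + rep F' :=
          huniq (F + F') (testOn_add (hrep_test F) (hrep_test F'))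
            ((Lp.coeFn_add (F : Lp ℝ Q ν) F').trans ((hrep_ae F).add (hrep_ae F')))
        simp only [h1]
        exact hadd _ _ (hrep_test F) (hrep_test F')
      map_smul' := fun a F => by
        have h1 : rep (a • F) = a • rep F :=
          huniq (a • F) (testOn_smul (hrep_test F) a)
            ((Lp.coeFn_smul a (F : Lp ℝ Q ν)).trans ((hrep_ae F).const_smul a))
        simp only [h1, RingHom.id_apply, smul_eq_mul]
        exact hsmul a _ (hrep_test F) }
  have hL0 : ∀ F : P, ‖L0 F‖ ≤ M * ‖F‖ := fun F => by
    have h1 := hbd (rep F) (hrep_test F)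
    rw [← hnorm (hrep_test F)] at h1
    have h2 : ‖(F : Lp ℝ Q ν)‖ = (eLpNorm (rep F) Q ν).toReal := by
      rw [Lp.norm_def]
      congr 1
      exact eLpNorm_congr_ae (hrep_ae F)
    rw [Real.norm_eq_abs, Submodule.coe_norm, h2]
    exact h1
  set L1 : P →L[ℝ] ℝ := L0.mkContinuous M hL0 with hL1
  -- Hahn–Banach extension
  obtain ⟨T, hText, -⟩ := exists_extension_norm_eq P L1
  -- Radon–Nikodym representation of `T`
  obtain ⟨g, hgi, hgT⟩ := exists_integrable_clm_eq_integral_mul (μ := ν) hQtop T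
  -- `Λ ψ = ∫_Ω g ψ` for test functions
  have hrepr : ∀ f : G → ℝ, IsTestFunctionOn Ω f → Λ f = ∫ x in (Ω : Set G), g x * f x ∂μ := by
    intro f hf
    obtain ⟨C, hC⟩ := hf.hasCompactSupport.exists_bound_of_continuous hf.contDiff.continuous
    have hFP : (hmem hf).toLp f ∈ P := ⟨f, hf, (hmem hf).coeFn_toLp⟩
    have h1 : T ((hmem hf).toLp f) = Λ f := by
      rw [hText ⟨_, hFP⟩, hL1, LinearMap.mkContinuous_apply]
      show Λ (rep ⟨_, hFP⟩) = Λ f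
      rw [huniq ⟨_, hFP⟩ hf ((hmem hf).coeFn_toLp)]
    rw [← h1, hgT f hf.contDiff.continuous.stronglyMeasurable ⟨C, hC⟩ (hmem hf)]
  -- the `L^p` bound by the easy half of the duality
  have hgΩ : IntegrableOn g (Ω : Set G) μ := hgi
  have hdual := memLp_of_forall_test (μ := μ) Ω.isOpen hgΩ hpq hM fun Ψ hΨ hΨc hΨs => by
    have hΨt : IsTestFunctionOn Ω Ψ := ⟨hΨ, hΨc, hΨs⟩
    rw [← hrepr Ψ hΨt]
    exact hbd Ψ hΨt
  exact ⟨g, hdual.1, hdual.2, hrepr⟩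

end TestFunctions

end Literature.Analysis.FunctionSpaces

end
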